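import Mathlib
import Summits.NavierStokesRegularity.NavierStokesRegularity.Theorems.WakeRatchetTailRatchetScalarFrontEdge
import HarnessLib

/-!
# Scalar dyadic fronts (construction `DyadicScalarFronts`, stmt-NavierStokesRegularity-21808):
# the LEADING EDGE carries little action — `∫_{t ≤ τ_e} a(t) dt ≤ (log s)/Λ` once `|t|a(t) ≤ 1/(2Λ)` beyond `τ_e`

Support file for the crux `WakeRatchet.TailRatchet` (stmt-21808; refuted BY NAME modulo the construction
`WakeRatchetDyadicFront.DyadicScalarFronts`, p589335; MODEL lattice ODEs of Tao 2016 §1.2, §4 — nothing here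
concerns the Navier–Stokes equations, and no item is closed).  Second brick of the one remaining a-priori SIZE
bound of programme R-glob (census memo `G2G3-APRIORI-21808-leafhand4-g6.md`; the wake side is
`…ScalarFrontWakeZone`): the action spent in the leading edge.

If `|u|·a(u) ≤ 1/(2Λ)` for all `u ≤ τ_e` (`τ_e < 0`; such a `τ_e` exists for every profile of
`DyadicScalarFronts` by `WakeRatchetScalarFrontEdge.amp_tendsto_zero`), the iterated squaring law
(`WakeRatchetScalarFrontEdge.amp_le_iter`) gives `|u|a(u) ≤ Λ⁻¹2^{−2^k}` on `(−∞, s^k τ_e]`, hence on each rung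
`[s^{k+1}τ_e, s^k τ_e]` the action is at most `Λ⁻¹2^{−2^k}·log s` (`rung_action_le`), and summing
(`Σ_k 2^{−2^k} ≤ 1`):
* `edge_action_partial` — `∫_{s^k τ_e}^{τ_e} a ≤ (log s)/Λ` for every `k`;
* `edge_action_le` — `∫_{t < τ_e} a(t) dt ≤ (log s)/Λ`.

With `…ScalarFrontWakeZone.wakeZone_action_le` (`≤ 1/(4Λ)` on the wake zone) the action of an admissible front
is `A ≤ 1/(4Λ) + (log s)/Λ + (action of the bulk between the two zones)`: the size bound reduces to the BULK.

HONEST FRAMING: elementary real analysis about a MODEL lattice ODE; existence of fronts is NOT proved; the bulk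
bound stays open (and may hold only branch-locally: log-periodic drain-free tails near `s ≈ 1.83` suggest long
plateaus); nothing about Navier–Stokes.
-/

noncomputable section

set_option linter.dupNamespace false

namespace Summit.NavierStokesRegularity.NavierStokesRegularity.Theorems

namespace WakeRatchetScalarFrontEdgeAction

open Filter Topology Set MeasureTheory intervalIntegral
open Literature.Analysis.FluidPDE Literature.Analysis.FluidPDE.TaoCascade
open WakeRatchetScalarFrontWake WakeRatchetScalarFrontPositive WakeRatchetScalarFrontAdmissible
open WakeRatchetScalarFrontEdge

variable {ε₀ s : ℝ} {a : ℝ → ℝ}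

/-- **Action of one rung of the edge.**  If `0 ≤ a` and `|u|·a(u) ≤ C` on `(−∞, T]` (`T < 0`, `s > 1`), then
`∫_{sT}^{T} a ≤ C·log s`. [elementary] -/
theorem rung_action_le (hs : 1 < s) (hint : IntegrableOn a (Iio 0)) (hnn : ∀ t : ℝ, t < 0 → 0 ≤ a t)
    {T C : ℝ} (hT : T < 0) (hC : ∀ u : ℝ, u ≤ T → -u * a u ≤ C) :
    ∫ u in (s * T)..T, a u ≤ C * Real.log s := by
  have hs0 : 0 < s := by linarith
  have hsT : s * T < T := by nlinarith
  have hsT0 : s * T < 0 := by nlinarith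
  have h0notin : (0 : ℝ) ∉ uIcc (s * T) T := by
    rw [uIcc_of_le hsT.le]; intro h0; linarith [h0.2]
  have hC0 : 0 ≤ C := le_trans (mul_nonneg (by linarith) (hnn T hT)) (hC T le_rfl)
  have hIa : IntervalIntegrable a volume (s * T) T := by
    rw [intervalIntegrable_iff_integrableOn_Ioc_of_le hsT.le]
    exact hint.mono_set fun u hu => lt_of_le_of_lt hu.2 hT
  have hIinv : IntervalIntegrable (fun u : ℝ => -C * u⁻¹) volume (s * T) T :=
    (intervalIntegrable_inv_iff.2 (Or.inr h0notin)).const_mul (-C)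
  have hmono : ∫ u in (s * T)..T, a u ≤ ∫ u in (s * T)..T, -C * u⁻¹ := by
    refine intervalIntegral.integral_mono_on hsT.le hIa hIinv fun u hu => ?_
    have hu0 : u < 0 := lt_of_le_of_lt hu.2 hT
    have hnu : 0 < -u := by linarith
    have h := hC u hu.2
    have e : -C * u⁻¹ = C / (-u) := by field_simp
    rw [e, le_div_iff₀ hnu]
    linarith
  have hval : ∫ u in (s * T)..T, -C * u⁻¹ = C * Real.log s := by
    rw [intervalIntegral.integral_const_mul, integral_inv h0notin]
    have e : T / (s * T) = s⁻¹ := by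
      rw [mul_comm s T, div_mul_eq_div_div, div_self hT.ne, one_div]
    rw [e, Real.log_inv]; ring
  linarith

/-- `Σ_{j<k} 2^{-2^j} ≤ 1` (compare with the geometric series `Σ 2^{-(j+1)} = 1`). [elementary] -/
theorem sum_two_pow_two_pow_le (k : ℕ) :
    (∑ j ∈ Finset.range k, ((1 : ℝ) / 2) ^ (2 ^ j)) ≤ 1 := by
  have h1 : ∀ j ∈ Finset.range k, ((1 : ℝ) / 2) ^ (2 ^ j) ≤ (1 / 2) * (1 / 2) ^ j := by
    intro j _
    rw [← pow_succ']
    exact pow_le_pow_of_le_one (by norm_num) (by norm_num) (Nat.succ_le_of_lt (Nat.lt_two_pow_self))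
  calc (∑ j ∈ Finset.range k, ((1 : ℝ) / 2) ^ (2 ^ j))
      ≤ ∑ j ∈ Finset.range k, (1 / 2) * ((1 : ℝ) / 2) ^ j := Finset.sum_le_sum h1
    _ = (1 / 2) * ∑ j ∈ Finset.range k, ((1 : ℝ) / 2) ^ j := by rw [Finset.mul_sum]
    _ ≤ (1 / 2) * 2 := mul_le_mul_of_nonneg_left (sum_geometric_two_le k) (by norm_num)
    _ = 1 := by norm_num

/-- **Edge action, partial sums.**  If `0 ≤ a`, `a → 0` at `−∞`, and `|u|·a(u) ≤ 1/(2Λ)` on `(−∞, τ_e]`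
(`τ_e < 0`), then `∫_{s^k τ_e}^{τ_e} a ≤ (log s)/Λ` for every `k`.
[cite: Tao2016AveragedNS, §1.2 (dyadic model); elementary] -/
theorem edge_action_partial (hε : 0 < ε₀) (hs : 1 < s)
    (hode : ∀ t : ℝ, t < 0 → HasDerivAt a
      (bigLam ε₀ / s ^ 2 * a (t / s) ^ 2 - s / bigLam ε₀ * a t * a (s * t)) t)
    (hint : IntegrableOn a (Iio 0)) (hnn : ∀ t : ℝ, t < 0 → 0 ≤ a t) (hbot : Tendsto a atBot (𝓝 0))
    {τe : ℝ} (hτe : τe < 0) (hedge : ∀ u : ℝ, u ≤ τe → -u * a u ≤ 1 / (2 * bigLam ε₀)) (k : ℕ) :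
    ∫ u in (s ^ k * τe)..τe, a u ≤ Real.log s / bigLam ε₀ := by
  have hs0 : 0 < s := by linarith
  have hΛ : 0 < bigLam ε₀ := bigLam_pos (by linarith)
  have hlog : 0 ≤ Real.log s := Real.log_nonneg hs.le
  -- rung bound from the iterated squaring law: on `(−∞, s^j τe]`, `|u|a ≤ Λ⁻¹ (1/2)^{2^j}`
  have hrung : ∀ j : ℕ, ∀ u : ℝ, u ≤ s ^ j * τe → -u * a u ≤ (bigLam ε₀)⁻¹ * (1 / 2) ^ (2 ^ j) := by
    intro j u hu
    have h := amp_le_iter hε hs hode hnn hbot hτe hedge j u hu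
    have e : bigLam ε₀ * (1 / (2 * bigLam ε₀)) = 1 / 2 := by field_simp
    rwa [e] at h
  -- interval integrability on each rung
  have hIa : ∀ x y : ℝ, x ≤ y → y < 0 → IntervalIntegrable a volume x y := by
    intro x y hxy hy
    rw [intervalIntegrable_iff_integrableOn_Ioc_of_le hxy]
    exact hint.mono_set fun u hu => lt_of_le_of_lt hu.2 hy
  -- the partial integral as a sum over rungs, by induction
  have hneg : ∀ j : ℕ, s ^ j * τe < 0 := fun j => mul_neg_of_pos_of_neg (pow_pos hs0 j) hτe
  have claim : ∀ k : ℕ, ∫ u in (s ^ k * τe)..τe, a u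
      ≤ (Real.log s / bigLam ε₀) * ∑ j ∈ Finset.range k, ((1 : ℝ) / 2) ^ (2 ^ j) := by
    intro k
    induction k with
    | zero => simp
    | succ k ih =>
      have hsplit : ∫ u in (s ^ (k + 1) * τe)..τe, a u
          = (∫ u in (s ^ (k + 1) * τe)..(s ^ k * τe), a u) + ∫ u in (s ^ k * τe)..τe, a u := by
        rw [intervalIntegral.integral_add_adjacent_intervals]
        · apply hIa
          · rw [pow_succ]; nlinarith [hneg k]
          · exact hneg k
        · apply hIa
          · have : (1:ℝ) ≤ s ^ k := one_le_pow₀ hs.le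
            nlinarith
          · exact hτe
      have hpiece : ∫ u in (s ^ (k + 1) * τe)..(s ^ k * τe), a u
          ≤ (bigLam ε₀)⁻¹ * (1 / 2) ^ (2 ^ k) * Real.log s := by
        have e : s ^ (k + 1) * τe = s * (s ^ k * τe) := by rw [pow_succ]; ring
        rw [e]
        exact rung_action_le hs hint hnn (hneg k) (hrung k)
      rw [hsplit, Finset.sum_range_succ, mul_add]
      have e2 : Real.log s / bigLam ε₀ * ((1:ℝ) / 2) ^ (2 ^ k)
          = (bigLam ε₀)⁻¹ * (1 / 2) ^ (2 ^ k) * Real.log s := by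
        rw [div_eq_mul_inv]; ring
      rw [e2]
      linarith
  calc ∫ u in (s ^ k * τe)..τe, a u
      ≤ (Real.log s / bigLam ε₀) * ∑ j ∈ Finset.range k, ((1 : ℝ) / 2) ^ (2 ^ j) := claim k
    _ ≤ (Real.log s / bigLam ε₀) * 1 :=
        mul_le_mul_of_nonneg_left (sum_two_pow_two_pow_le k) (div_nonneg hlog hΛ.le)
    _ = Real.log s / bigLam ε₀ := mul_one _

/-- **Edge action.**  Under the same hypotheses `∫_{t < τ_e} a(t) dt ≤ (log s)/Λ`.
[cite: Tao2016AveragedNS, §1.2 (dyadic model); elementary] -/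
theorem edge_action_le (hε : 0 < ε₀) (hs : 1 < s)
    (hode : ∀ t : ℝ, t < 0 → HasDerivAt a
      (bigLam ε₀ / s ^ 2 * a (t / s) ^ 2 - s / bigLam ε₀ * a t * a (s * t)) t)
    (hint : IntegrableOn a (Iio 0)) (hnn : ∀ t : ℝ, t < 0 → 0 ≤ a t) (hbot : Tendsto a atBot (𝓝 0))
    {τe : ℝ} (hτe : τe < 0) (hedge : ∀ u : ℝ, u ≤ τe → -u * a u ≤ 1 / (2 * bigLam ε₀)) :
    ∫ u in Iio τe, a u ≤ Real.log s / bigLam ε₀ := by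
  have hs0 : 0 < s := by linarith
  -- `s^k τe → −∞`
  have hseq : Tendsto (fun k : ℕ => s ^ k * τe) atTop atBot := by
    have h1 : Tendsto (fun k : ℕ => s ^ k) atTop atTop := tendsto_pow_atTop_atTop_of_one_lt hs
    exact h1.atTop_mul_const_of_neg hτe
  have hIic : IntegrableOn a (Iic τe) := hint.mono_set (Iic_subset_Iio.2 hτe)
  have hlim := intervalIntegral_tendsto_integral_Iic τe hIic hseq
  rw [integral_Iic_eq_integral_Iio] at hlim
  exact le_of_tendsto' hlim fun k => edge_action_partial hε hs hode hint hnn hbot hτe hedge k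

/-- **Edge action for the construction item.**  Every profile of `DyadicScalarFronts` has a time `τ_e < 0` with
`|u|·a(u) ≤ 1/(2Λ)` for `u ≤ τ_e` and `∫_{t<τ_e} a ≤ (log s)/Λ`.
[cite: Tao2016AveragedNS, §1.2, §4; elementary] -/
theorem edge_action_of_front (hε : 0 < ε₀) (hs : 1 < s)
    (hode : ∀ t : ℝ, t < 0 → HasDerivAt a
      (bigLam ε₀ / s ^ 2 * a (t / s) ^ 2 - s / bigLam ε₀ * a t * a (s * t)) t)
    (hint : IntegrableOn a (Iio 0))
    (hbdd : ∃ t₀ : ℝ, t₀ < 0 ∧ ∃ P : ℝ, ∀ t : ℝ, t₀ ≤ t → t < 0 → |a t| ≤ P) :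
    ∃ τe : ℝ, τe < 0 ∧ (∀ u : ℝ, u ≤ τe → -u * a u ≤ 1 / (2 * bigLam ε₀)) ∧
      ∫ u in Iio τe, a u ≤ Real.log s / bigLam ε₀ := by
  have hΛ : 0 < bigLam ε₀ := bigLam_pos (by linarith)
  have hnn := nonneg_of_front hε hs hode hint hbdd
  have hbot := tendsto_atBot hε hs hode hint hbdd
  have hg := amp_tendsto_zero hε hs hode hint hbdd
  have hM0 : 0 < 1 / (2 * bigLam ε₀) := by positivity
  have hev := (Metric.tendsto_nhds.1 hg) _ hM0
  obtain ⟨τe, hτe⟩ := (hev.and (eventually_lt_atBot (0 : ℝ))).exists_forall_of_atBot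
  have hedge : ∀ u : ℝ, u ≤ τe → -u * a u ≤ 1 / (2 * bigLam ε₀) := by
    intro u hu
    have h := (hτe u hu).1
    rw [Real.dist_eq, sub_zero] at h
    exact (le_abs_self _).trans h.le
  exact ⟨τe, (hτe τe le_rfl).2, hedge, edge_action_le hε hs hode hint hnn hbot (hτe τe le_rfl).2 hedge⟩

end WakeRatchetScalarFrontEdgeAction

end Summit.NavierStokesRegularity.NavierStokesRegularity.Theorems

end
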